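import Summits.NavierStokesRegularity.FluidComputer.ClayBlowupLocalAlignment
import Literature.Analysis.FluidPDE.OseenMildUniqueness
import Literature.Analysis.FluidPDE.KNSSLocalSmoothingHolds
import HarnessLib

/-!
# A UNIVERSAL LERAY RATE AT EVERY SINGULAR POINT, WITH THE CLAY FORCE: bounded ancient mild solutions
# with a SMALL Type I constant vanish, so `√((T−t)/ν) · sup_{B(x₁,r₀)} ‖u(t)‖ ≥ ε₀` infinitely often

Cell `ns-blowup`, seat `ns-blowup-ecbridge-2` (g11; the E–C endpoint theory seat). LABEL: E–C typing
(KERNEL — no named fact, no new definition). WHAT THIS IS NOT: not Navier–Stokes evidence — a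
necessary condition on the TYPE `ClayBlowup ν` with its Clay force; no inhabitant is claimed.
Companion memo: `run/shared/lean/pub/ns-blowup/ecbridge2/ECBRIDGE-2-MEMO-10.md` (§4 (a)).

## Content

`ClayBlowupLocalTypeIScale.lean` shows that near a singular point the velocity exceeds `ε/√(T − t)`
for SOME `ε > 0` depending on the point. Here the constant becomes UNIVERSAL (it depends on nothing),
through a small-constant Liouville theorem for the blow-up limit:

* `small_typeI_ancient_eq_zero` — there is `ε₀ > 0` (KNSS's local-smoothing constant `√ε`, Prop 4.1)
  such that every continuous bounded ancient Oseen-mild field `W` on `(−∞, 0) × ℝ³` (viscosity `1`)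
  with `√(−s) ‖W(s, z)‖ ≤ ε₀` vanishes identically. Proof: from the datum `W(s₀)`
  (`‖W(s₀)‖_∞ ≤ ε₀/√(−s₀) =: M`) KNSS's bounded mild solution (`knss2009_local_smoothing_holds`) lives
  on `(s₀, s₀ + ε/M²) = (s₀, 0)` with bound `C M`; bounded Oseen-mild solutions are unique
  (`oseenMild_bounded_unique`), so `‖W‖ ≤ Cε₀/√(−s₀)` on `(s₀, 0)`; let `s₀ → −∞`.
* `ClayBlowup.not_local_small_typeI_one`, **`ClayBlowup.not_local_small_typeI`** — with the SAME
  `ε₀` for every `ν > 0`, every Clay blow-up, every point `x₁` not backward bounded and every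
  `r₀ > 0`: `¬ ∀ᶠ t ↑ T, ∀ x ∈ B(x₁, r₀), ‖u(t, x)‖ ≤ ε₀ √ν/√(T − t)` (the local zoom limit would
  have Type I constant `≤ ε₀`); **`ClayBlowup.exists_universal_local_leray_rate`** — the
  `∃ t ∈ (t₀, T), x ∈ B(x₁, r₀), ‖u(t, x)‖ > ε₀ √ν/√(T − t)` form; `DesignedBlowup` twin. Leray's
  global rate `‖u(t)‖_∞ ≥ c√ν/√(T − t)` (tree `forced_leray_rate_sup`) thus holds LOCALLY at every
  singular point, along a sequence of times.

References: Koch–Nadirashvili–Seregin–Šverák, Acta Math. 203 (2009), Prop 4.1, §4 (4.3)–(4.4),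
Prop 6.1 [cite: KochNadirashviliSereginSverak2009, Prop. 4.1 with (4.3)–(4.5) (arXiv:0709.3599 p. 8)];
J. Leray, Acta Math. 63 (1934), (3.16) [cite: Leray1934, (3.16)]; C. L. Fefferman, (C)
[cite: FeffermanClay2006, (C)].
-/

noncomputable section

namespace Summit.NavierStokesRegularity.FluidComputer

open Set MeasureTheory Filter Topology Function Metric
open scoped ENNReal NNReal
open Literature.Analysis Literature.Analysis.FluidPDE
open Summit.NavierStokesRegularity.NavierStokesRegularity

/-! ## §1 Small Type I constant ⇒ the ancient mild solution vanishes -/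

/-- **BOUNDED ANCIENT MILD SOLUTIONS WITH A SMALL TYPE I CONSTANT VANISH** (viscosity `1`; no named
fact): there is a universal `ε₀ > 0` such that a continuous bounded field `W` on `(−∞, 0) × ℝ³` solving
`W(t) = e^{(t−s)Δ}W(s) − B¹_s(W, W)(t)` for `s < t < 0` and obeying `√(−s)‖W(s, z)‖ ≤ ε₀` is
identically zero. KNSS's Prop 4.1 (bounded mild solution from `L^∞` data on a slab of length
`ε/‖a‖_∞²`, bound `C‖a‖_∞`) from data at `s₀ → −∞`, plus uniqueness of bounded Oseen-mild solutions.
[cite: KochNadirashviliSereginSverak2009, Prop. 4.1 with (4.3)–(4.5) (arXiv:0709.3599 p. 8)] -/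
theorem small_typeI_ancient_eq_zero :
    ∃ ε₀ : ℝ, 0 < ε₀ ∧ ∀ (W : ℝ → EuclideanSpace ℝ (Fin 3) → EuclideanSpace ℝ (Fin 3)) (B : ℝ),
      ContinuousOn (uncurry W) (Iio 0 ×ˢ univ) → (∀ t < 0, ∀ z, ‖W t z‖ ≤ B) →
      (∀ s t : ℝ, s < t → t < 0 → ∀ z,
        W t z = UnboundedOperators.heatExtension (W s) (t - s) z - oseenDuhamel 1 s W W t z) →
      (∀ s < 0, ∀ z, Real.sqrt (-s) * ‖W s z‖ ≤ ε₀) → ∀ s < 0, ∀ z, W s z = 0 := by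
  obtain ⟨ε, hε, C, hC0, hloc⟩ := knss2009_local_smoothing_holds (E := EuclideanSpace ℝ (Fin 3)) 0 0
  refine ⟨Real.sqrt ε, Real.sqrt_pos.2 hε, fun W B hcont hB hmild hI s hs z => ?_⟩
  set ε₀ : ℝ := Real.sqrt ε with hε₀
  have hε₀0 : 0 < ε₀ := Real.sqrt_pos.2 hε
  have hWsc : ∀ t < 0, Continuous (W t) := fun t ht =>
    hcont.comp_continuous (Continuous.prodMk_right t) fun y => ⟨ht, mem_univ y⟩
  -- ### from data at any `s₀ < s`: `‖W(s, z)‖ ≤ C ε₀/√(−s₀)`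
  have key : ∀ s₀ < s, ‖W s z‖ ≤ C * ε₀ / Real.sqrt (-s₀) := by
    intro s₀ hs₀
    have hs₀0 : s₀ < 0 := hs₀.trans hs
    have hsq : 0 < Real.sqrt (-s₀) := Real.sqrt_pos.2 (by linarith)
    set M : ℝ := ε₀ / Real.sqrt (-s₀) with hM
    have hM0 : 0 < M := div_pos hε₀0 hsq
    -- the datum `a = W(s₀)`, `‖a‖_∞ ≤ M`
    have ham : AEStronglyMeasurable (W s₀) volume := (hWsc s₀ hs₀0).aestronglyMeasurable
    have haM : eLpNorm (W s₀) ∞ volume ≤ ENNReal.ofReal M := by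
      rw [eLpNorm_exponent_top]
      refine eLpNormEssSup_le_of_ae_bound (Eventually.of_forall fun y => ?_)
      rw [hM, le_div_iff₀ hsq, mul_comm]
      exact hI s₀ hs₀0 y
    -- KNSS's bounded mild solution lives exactly on `(s₀, 0)`
    have hend : s₀ + ε * 1 / M ^ 2 = 0 := by
      have hM2 : M ^ 2 = ε / (-s₀) := by
        rw [hM, div_pow, hε₀, Real.sq_sqrt hε.le, Real.sq_sqrt (by linarith)]
      rw [hM2]
      field_simp
      ring
    obtain ⟨v, hvs, hveq, hvM, -⟩ := hloc one_pos s₀ hM0 ham haM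
    rw [hend] at hvs hveq hvM
    have hvc : ∀ t ∈ Ioo s₀ 0, Continuous (v t) := fun t ht =>
      hvs.continuousOn.comp_continuous (Continuous.prodMk_right t) fun y => ⟨ht, mem_univ y⟩
    -- uniqueness of bounded Oseen-mild solutions on `(s₀, 0)`
    have hB0 : 0 ≤ max B (C * M) := le_max_of_le_right (by positivity)
    have hum : AEStronglyMeasurable (uncurry W)
        ((volume : Measure (ℝ × EuclideanSpace ℝ (Fin 3))).restrict (Ioo s₀ 0 ×ˢ univ)) :=
      (hcont.mono (prod_mono (fun t ht => ht.2) subset_rfl)).aestronglyMeasurable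
        (measurableSet_Ioo.prod MeasurableSet.univ)
    have hvm : AEStronglyMeasurable (uncurry v)
        ((volume : Measure (ℝ × EuclideanSpace ℝ (Fin 3))).restrict (Ioo s₀ 0 ×ˢ univ)) :=
      hvs.continuousOn.aestronglyMeasurable (measurableSet_Ioo.prod MeasurableSet.univ)
    have huniq := oseenMild_bounded_unique (u := W) (v := v)
      (U := fun t y => UnboundedOperators.heatExtension (W s₀) (t - s₀) y) one_pos hB0 hum hvm
      (fun τ hτ y => (hB τ hτ.2 y).trans (le_max_left _ _))
      (fun τ hτ y => (hvM τ hτ y).trans (le_max_right _ _))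
      (fun t ht => Eventually.of_forall fun y => hmild s₀ t ht.1 ht.2 y)
      (fun t ht => Eventually.of_forall fun y => by
        have h := hveq t ht y
        rw [one_mul] at h
        exact h)
    have heq : W s = v s :=
      ((hWsc s hs).ae_eq_iff_eq volume (hvc s ⟨hs₀, hs⟩)).1 (huniq s ⟨hs₀, hs⟩)
    rw [heq]
    calc ‖v s z‖ ≤ C * M := hvM s ⟨hs₀, hs⟩ z
      _ = C * ε₀ / Real.sqrt (-s₀) := by rw [hM]; ring
  -- ### let `s₀ → −∞`
  have hle : ∀ δ : ℝ, 0 < δ → ‖W s z‖ ≤ δ := by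
    intro δ hδ
    set s₀ : ℝ := min (s - 1) (-((C * ε₀ / δ) ^ 2 + 1)) with hs₀
    have hs₀s : s₀ < s := lt_of_le_of_lt (min_le_left _ _) (by linarith)
    have hneg : (C * ε₀ / δ) ^ 2 ≤ -s₀ := by
      have := min_le_right (s - 1) (-((C * ε₀ / δ) ^ 2 + 1))
      rw [← hs₀] at this
      linarith
    have hsq : C * ε₀ / δ ≤ Real.sqrt (-s₀) := Real.le_sqrt_of_sq_le hneg
    have hsq0 : 0 < Real.sqrt (-s₀) := Real.sqrt_pos.2 (by linarith [hs₀s.trans hs])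
    refine (key s₀ hs₀s).trans ?_
    rw [div_le_iff₀ hsq0]
    calc C * ε₀ = δ * (C * ε₀ / δ) := by field_simp
      _ ≤ δ * Real.sqrt (-s₀) := mul_le_mul_of_nonneg_left hsq hδ.le
  have h0 : ‖W s z‖ ≤ 0 := le_of_forall_pos_le_add fun δ hδ => by linarith [hle δ hδ]
  exact norm_le_zero_iff.1 h0

namespace ClayBlowup

/-! ## §2 The universal local Leray rate -/

/-- **A UNIVERSAL LOCAL LERAY RATE AT EVERY SINGULAR POINT (`ν = 1`, ANY Clay force; no named fact)**:
with the universal `ε₀` of `small_typeI_ancient_eq_zero`, at a point `x₁` which is not backward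
bounded the bound `‖u(t, x)‖ ≤ ε₀/√(T − t)` cannot hold near `T` on any ball `B(x₁, r₀)` — the local
zoom limit would be a nontrivial bounded ancient mild solution with Type I constant `≤ ε₀`.
[cite: KochNadirashviliSereginSverak2009, Prop 6.1 and Prop 4.1] [cite: Leray1934, (3.16)] -/
theorem not_local_small_typeI_one :
    ∃ ε₀ : ℝ, 0 < ε₀ ∧ ∀ (Y : ClayBlowup 1) (x₁ : EuclideanSpace ℝ (Fin 3)),
      ¬ IsBackwardBoundedAt Y.u Y.T x₁ → ∀ r₀ : ℝ, 0 < r₀ →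
        ¬ ∀ᶠ t in 𝓝[<] Y.T, ∀ x ∈ ball x₁ r₀, ‖Y.u t x‖ ≤ ε₀ / Real.sqrt (Y.T - t) := by
  obtain ⟨ε₀, hε₀, hLiou⟩ := small_typeI_ancient_eq_zero
  refine ⟨ε₀, hε₀, fun Y x₁ hx₁ r₀ hr₀ hC => ?_⟩
  have hT := Y.T_pos
  -- ### the local zoom at `x₁`
  have hr' : 0 < min 1 (r₀ / 2) := lt_min one_pos (by positivity)
  have ht_b : Y.T / 2 ∈ Ico 0 Y.T := ⟨by positivity, by linarith⟩
  obtain ⟨t, x, φ, W, hφ, ht, hx, hk1, hWc, -, hWmild, hW4, ⟨σ₁, hσ₁, hhalf⟩, hconv⟩ :=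
    Y.exists_local_zoom_limit hx₁ hr' (min_le_left _ _) ht_b
  obtain ⟨c, hc⟩ : ∃ c : ℕ → ℝ, ∀ k, c k = ‖Y.u (t k) (x k)‖⁻¹ := ⟨_, fun k => rfl⟩
  simp_rw [← hc] at hconv
  have hM0 : ∀ k, 0 < ‖Y.u (t k) (x k)‖ := fun k => lt_of_lt_of_le (by positivity) (hk1 k)
  have hc0 : ∀ k, 0 < c k := fun k => by rw [hc k]; exact inv_pos.2 (hM0 k)
  have htI : ∀ k, t k ∈ Ioo 0 Y.T := fun k => ⟨lt_of_lt_of_le (by positivity) (ht k).1, (ht k).2⟩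
  have hxr : ∀ k, dist (x k) x₁ < r₀ / 2 := fun k =>
    lt_of_lt_of_le (mem_ball.1 (hx k)) (min_le_right _ _)
  -- ### slice times → T⁻, amplitudes → 0
  have htT : Tendsto t atTop (𝓝[<] Y.T) := Y.tendsto_of_norm_ge one_pos htI hk1
  have hcto : Tendsto c atTop (𝓝 0) := by
    have hMto : Tendsto (fun k => ‖Y.u (t k) (x k)‖) atTop atTop := by
      refine tendsto_atTop_atTop.2 fun B => ⟨⌈B⌉₊, fun k hk => ?_⟩
      have h1 : (⌈B⌉₊ : ℝ) ≤ k := by exact_mod_cast hk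
      linarith [Nat.le_ceil B, hk1 k]
    exact (tendsto_inv_atTop_zero.comp hMto).congr fun k => by simp [Function.comp, hc k]
  have htime : ∀ s ≤ 0, Tendsto (fun j => t (φ j) + c (φ j) ^ 2 * s) atTop (𝓝[<] Y.T) := by
    intro s hs
    have h1 : Tendsto (fun j => t (φ j)) atTop (𝓝 Y.T) :=
      (tendsto_nhdsWithin_iff.1 htT).1.comp hφ.tendsto_atTop
    have h2 : Tendsto (fun j => c (φ j) ^ 2 * s) atTop (𝓝 0) := by
      simpa using ((hcto.comp hφ.tendsto_atTop).pow 2).mul_const s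
    refine tendsto_nhdsWithin_iff.2 ⟨by simpa using h1.add h2, Eventually.of_forall fun j => ?_⟩
    have : c (φ j) ^ 2 * s ≤ 0 := mul_nonpos_of_nonneg_of_nonpos (sq_nonneg _) hs
    exact lt_of_le_of_lt (by linarith) (ht (φ j)).2
  have hsqrt : ∀ s ≤ 0, ∀ j, c (φ j) * Real.sqrt (-s) ≤
      Real.sqrt (Y.T - (t (φ j) + c (φ j) ^ 2 * s)) := by
    intro s hs j
    have e1 : c (φ j) * Real.sqrt (-s) = Real.sqrt (c (φ j) ^ 2 * -s) := by
      rw [Real.sqrt_mul (sq_nonneg _), Real.sqrt_sq (hc0 _).le]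
    rw [e1]
    refine Real.sqrt_le_sqrt ?_
    have e2 : c (φ j) ^ 2 * -s = -(c (φ j) ^ 2 * s) := by ring
    rw [e2]
    linarith [(ht (φ j)).2]
  have hsmall : ∀ A : ℝ, ∀ᶠ j in atTop, c (φ j) * A < r₀ / 4 := fun A => by
    have h : Tendsto (fun j => c (φ j) * A) atTop (𝓝 (0 * A)) :=
      (hcto.comp hφ.tendsto_atTop).mul_const A
    rw [zero_mul] at h
    exact h.eventually (gt_mem_nhds (by positivity))
  have hball : ∀ j (z : EuclideanSpace ℝ (Fin 3)), c (φ j) * ‖z‖ < r₀ / 2 →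
      x (φ j) + c (φ j) • z ∈ ball x₁ r₀ := by
    intro j z hz
    rw [mem_ball, dist_eq_norm]
    have e : x (φ j) + c (φ j) • z - x₁ = (x (φ j) - x₁) + c (φ j) • z := by abel
    rw [e]
    have h1 : ‖x (φ j) - x₁‖ < r₀ / 2 := by rw [← dist_eq_norm]; exact hxr _
    have h2 : ‖c (φ j) • z‖ < r₀ / 2 := by
      rwa [norm_smul, Real.norm_of_nonneg (hc0 _).le]
    linarith [norm_add_le (x (φ j) - x₁) (c (φ j) • z)]
  -- ### the bound passes to the limit: Type I constant `≤ ε₀`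
  have hIW : ∀ s < 0, ∀ z, Real.sqrt (-s) * ‖W s z‖ ≤ ε₀ := by
    intro s hs z
    have hs0 : 0 < Real.sqrt (-s) := Real.sqrt_pos.2 (by linarith)
    refine le_of_tendsto (((hconv s hs z).norm).const_mul _) ?_
    filter_upwards [(htime s hs.le).eventually hC, hsmall ‖z‖] with j hj hjz
    rw [norm_smul, Real.norm_of_nonneg (hc0 (φ j)).le]
    have h1 := hj (x (φ j) + c (φ j) • z) (hball j z (by linarith))
    have h2 := hsqrt s hs.le j
    have hTt : 0 < Real.sqrt (Y.T - (t (φ j) + c (φ j) ^ 2 * s)) :=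
      lt_of_lt_of_le (mul_pos (hc0 _) hs0) h2
    have hcφ : 0 ≤ c (φ j) := (hc0 _).le
    calc Real.sqrt (-s) * (c (φ j) * ‖Y.u (t (φ j) + c (φ j) ^ 2 * s) (x (φ j) + c (φ j) • z)‖)
        ≤ Real.sqrt (-s) * (c (φ j) * (ε₀ / Real.sqrt (Y.T - (t (φ j) + c (φ j) ^ 2 * s)))) := by
          gcongr
      _ = ε₀ * (c (φ j) * Real.sqrt (-s) / Real.sqrt (Y.T - (t (φ j) + c (φ j) ^ 2 * s))) := by
          ring
      _ ≤ ε₀ * 1 := by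
          gcongr
          rw [div_le_one hTt]; exact h2
      _ = ε₀ := mul_one ε₀
  -- ### the Liouville theorem kills the limit, against its nontriviality near the vertex
  have hzero := hLiou W 4 hWc hW4 hWmild hIW
  have h := hhalf (-(σ₁ / 2)) ⟨by linarith, by linarith⟩
  rw [hzero _ (by linarith), norm_zero] at h
  linarith

/-- **A UNIVERSAL LOCAL LERAY RATE AT EVERY SINGULAR POINT, WITH THE CLAY FORCE** (every `ν > 0`;
no named fact): there is ONE `ε₀ > 0` such that for every `ν > 0`, every Clay blow-up at viscosity
`ν`, every point `x₁` not backward bounded at `T` and every `r₀ > 0`, the bound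
`‖u(t, x)‖ ≤ ε₀ √ν/√(T − t)` near `T` on `B(x₁, r₀)` FAILS (viscosity normalisation: the constant
`ε₀ √ν` becomes `ε₀`). [cite: KochNadirashviliSereginSverak2009, Prop 6.1 and Prop 4.1] [cite: Leray1934, (3.16)] -/
theorem not_local_small_typeI :
    ∃ ε₀ : ℝ, 0 < ε₀ ∧ ∀ {ν : ℝ} (hν : 0 < ν) (X : ClayBlowup ν) (x₁ : EuclideanSpace ℝ (Fin 3)),
      ¬ IsBackwardBoundedAt X.u X.T x₁ → ∀ r₀ : ℝ, 0 < r₀ →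
        ¬ ∀ᶠ t in 𝓝[<] X.T, ∀ x ∈ ball x₁ r₀,
          ‖X.u t x‖ ≤ ε₀ * Real.sqrt ν / Real.sqrt (X.T - t) := by
  obtain ⟨ε₀, hε₀, h1⟩ := not_local_small_typeI_one
  refine ⟨ε₀, hε₀, fun {ν} hν X x₁ hx₁ r₀ hr₀ hC => ?_⟩
  refine h1 (X.rescale hν one_pos) x₁
    (fun h => hx₁ (X.isBackwardBoundedAt_of_rescale hν one_pos h)) r₀ hr₀ ?_
  have h := X.eventually_localTypeI_rescale hν one_pos hC
  have hsν : 0 < Real.sqrt ν := Real.sqrt_pos.2 hν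
  have e : (1 : ℝ) / ν / Real.sqrt (1 / ν) * (ε₀ * Real.sqrt ν) = ε₀ := by
    rw [Real.sqrt_div' 1 hν.le]  -- `√(1/ν) = √1/√ν`
    rw [Real.sqrt_one]
    field_simp
    rw [Real.sq_sqrt hν.le]
  rw [e] at h
  exact h

/-- **THE `∃` FORM: the velocity exceeds `ε₀ √ν/√(T − t)` — ONE `ε₀` FOR ALL CLAY BLOW-UPS — inside
every `(t₀, T) × B(x₁, r₀)` around every singular point.** [cite: Leray1934, (3.16)]
[cite: KochNadirashviliSereginSverak2009, Prop 6.1 and Prop 4.1] -/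
theorem exists_universal_local_leray_rate :
    ∃ ε₀ : ℝ, 0 < ε₀ ∧ ∀ {ν : ℝ} (hν : 0 < ν) (X : ClayBlowup ν) (x₁ : EuclideanSpace ℝ (Fin 3)),
      ¬ IsBackwardBoundedAt X.u X.T x₁ → ∀ r₀ : ℝ, 0 < r₀ → ∀ t₀ < X.T,
        ∃ t ∈ Ioo t₀ X.T, ∃ x ∈ ball x₁ r₀,
          ε₀ * Real.sqrt ν / Real.sqrt (X.T - t) < ‖X.u t x‖ := by
  obtain ⟨ε₀, hε₀, h1⟩ := not_local_small_typeI
  refine ⟨ε₀, hε₀, fun {ν} hν X x₁ hx₁ r₀ hr₀ t₀ ht₀ => ?_⟩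
  by_contra hcon
  push Not at hcon
  refine h1 hν X x₁ hx₁ r₀ hr₀ ?_
  filter_upwards [Ioo_mem_nhdsLT ht₀] with t ht x hx
  exact hcon t ht x hx

end ClayBlowup

/-- **The universal local Leray rate for designed blow-ups, with their force.** [cite: Leray1934, (3.16)]
[cite: KochNadirashviliSereginSverak2009, Prop 6.1 and Prop 4.1] -/
theorem DesignedBlowup.exists_universal_local_leray_rate :
    ∃ ε₀ : ℝ, 0 < ε₀ ∧ ∀ {ν : ℝ} (hν : 0 < ν) (D : DesignedBlowup ν) (x₁ : EuclideanSpace ℝ (Fin 3)),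
      ¬ IsBackwardBoundedAt D.u D.T x₁ → ∀ r₀ : ℝ, 0 < r₀ → ∀ t₀ < D.T,
        ∃ t ∈ Ioo t₀ D.T, ∃ x ∈ ball x₁ r₀,
          ε₀ * Real.sqrt ν / Real.sqrt (D.T - t) < ‖D.u t x‖ := by
  obtain ⟨ε₀, hε₀, h⟩ := ClayBlowup.exists_universal_local_leray_rate
  exact ⟨ε₀, hε₀, fun hν D x₁ hx₁ r₀ hr₀ t₀ ht₀ => h hν D.toClayBlowup x₁ hx₁ r₀ hr₀ t₀ ht₀⟩

end Summit.NavierStokesRegularity.FluidComputer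

end
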